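import Summits.CriticalPhenomena.PercolationContinuityZ3.Theorems.Transplant.HexShadowRouteData
import Summits.CriticalPhenomena.PercolationContinuityZ3.Theorems.Transplant.SqShadowDefs
import HarnessLib

/-!
# SQUARE SHADOWS — port of «HexShadowRouteData» to the square-shadow interface: the routing data of the local surgery, SWAP PAIRS, the square clipped blocks `sqBlk`, and the instance node `SqShadow.LocalLinkage`

builds on p205010 (kernel theorem, internal audit signed; external expert review pending) — NOT used in this file.  Lane `prim-bschramm`, seat `prim-bschramm-p2` (gen 42; class C1b;
memo §148); helper file (`--supports stmt-CriticalPhenomena-4575 --as helper`).  Statements and proofs from the hexagonal twin with `Ψ : SqShadow G` for `Φ : HexShadow G`, sup-norm squares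
`sqBall` for lattice hexagons, and the square clipped blocks `sqBlk z t s = sqBall z 3 ∩ {w₀ ≤ z₀ + t} ∩ {w₁ ≤ z₁ + s}` (clipping at the common right side of `B_{3n}`, `B'_n` and at
the top of the window) for the hexagonal ones.
[cite: DuminilCopinSidoraviciusTassion2016, §2.3 (proof of Fact 2, pp. 6–7)] [cite: NewmanTassionWu2017, §3.2]
-/

noncomputable section

namespace Summit.CriticalPhenomena.PercolationContinuityZ3.Theorems.Transplant

open MeasureTheory Literature.Probability.Percolation Literature.Probability.LatticeModels SimpleGraph Filter
open scoped Classical Topology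

/-! ## §1 Routing data -/

/-- **The routing data of one local surgery** (DST's three disjoint paths, in the form `SqShadow.Surgery` consumes): the rerouted piece `P` — with
`E₁ :: P ++ [E₂]` a self-avoiding `G`-chain whose interior lies over `RP` —, the attachment vertex `c` with its successor `y` on that chain, and the branch
`Br ≠ []` — a self-avoiding `G`-chain `c :: Br` ending at `w'`, over `D`, off the rerouted chain.
[cite: DuminilCopinSidoraviciusTassion2016, §2.3, proof of Fact 2 (γ_u, γ_v, γ_w)] -/
structure SqShadow.RouteData {V : Type} {G : SimpleGraph V} (Ψ : SqShadow G) (RP D : Set (Site 2)) (E₁ E₂ w' : V) where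
  /-- the rerouted piece, strictly between `E₁` and `E₂` -/
  P : List V
  /-- the attachment vertex -/
  c : V
  /-- the successor of `c` on `E₁ :: P ++ [E₂]` -/
  y : V
  /-- the branch, from a neighbour of `c` to `w'` -/
  Br : List V
  hP : ∀ x ∈ P, Ψ.sh x ∈ RP
  hchain : (E₁ :: (P ++ [E₂])).IsChain (fun a b => G.Adj a b)
  hnodup : (E₁ :: (P ++ [E₂])).Nodup
  hy : ∃ l₁ l₂ : List V, E₁ :: (P ++ [E₂]) = l₁ ++ c :: y :: l₂
  hBr : Br ≠ []
  hBrD : ∀ x ∈ Br, Ψ.sh x ∈ D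
  hBrchain : (c :: Br).IsChain (fun a b => G.Adj a b)
  hBrnodup : (c :: Br).Nodup
  hBrSP : ∀ x ∈ Br, x ∉ E₁ :: (P ++ [E₂])
  hBrlast : Br.getLast hBr = w'

namespace SqShadow.RouteData

variable {V : Type} {G : SimpleGraph V} {Ψ : SqShadow G} {RP D : Set (Site 2)} {E₁ E₂ w' : V} (r : Ψ.RouteData RP D E₁ E₂ w')

/-- The rerouted chain `E₁ :: P ++ [E₂]`. [cite: DuminilCopinSidoraviciusTassion2016, §2.3, proof of Fact 2] -/
def SP : List V := E₁ :: (r.P ++ [E₂])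

/-- The first branch vertex `b = Br.head`. [cite: DuminilCopinSidoraviciusTassion2016, §2.3, proof of Fact 2 (the vertex w)] -/
def b : V := r.Br.head r.hBr

/-- **The order condition follows from the key comparison of `y` and `b`**: the successor of `c` on the rerouted chain is `y`. [folklore] -/
theorem hfwd_of_key (r : Ψ.RouteData RP D E₁ E₂ w') [Countable V] (hkey : vtxKey V r.y < vtxKey V r.b) :
    ∀ (l₁ l₂ : List V) (y' : V), E₁ :: (r.P ++ [E₂]) = l₁ ++ r.c :: y' :: l₂ → vtxKey V y' < vtxKey V (r.Br.head r.hBr) := by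
  intro l₁ l₂ y' h
  obtain ⟨m₁, m₂, hm⟩ := r.hy
  rw [← HexShadow.RouteData.succ_unique r.hnodup hm h]
  exact hkey

/-- `c` lies on `E₁ :: P` (it has a successor on the chain). [folklore] -/
theorem c_mem (r : Ψ.RouteData RP D E₁ E₂ w') : r.c ∈ E₁ :: r.P := by
  obtain ⟨l₁, l₂, h⟩ := r.hy
  have hcSP : r.c ∈ E₁ :: (r.P ++ [E₂]) := by rw [h]; simp
  have hne : r.c ≠ E₂ := by
    have := HexShadow.RouteData.ne_getLast_of_succ h r.hnodup (List.cons_ne_nil _ _)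
    simpa using this
  simp only [List.mem_cons, List.mem_append, List.not_mem_nil, or_false] at hcSP ⊢
  rcases hcSP with h1 | h1 | h1
  · exact Or.inl h1
  · exact Or.inr h1
  · exact absurd h1 hne

/-- `y` lies on the rerouted chain. [folklore] -/
theorem y_mem_SP (r : Ψ.RouteData RP D E₁ E₂ w') : r.y ∈ E₁ :: (r.P ++ [E₂]) := by
  obtain ⟨l₁, l₂, h⟩ := r.hy; rw [h]; simp

/-- `b` lies on the branch. [folklore] -/
theorem b_mem_Br (r : Ψ.RouteData RP D E₁ E₂ w') : r.b ∈ r.Br := List.head_mem _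

/-- `c` and `y` are adjacent. [folklore] -/
theorem adj_c_y (r : Ψ.RouteData RP D E₁ E₂ w') : G.Adj r.c r.y := by
  obtain ⟨l₁, l₂, h⟩ := r.hy
  have hch := r.hchain
  rw [h, List.isChain_append] at hch
  exact (List.isChain_cons_cons.1 hch.2.1).1

/-- `c` and `b` are adjacent. [folklore] -/
theorem adj_c_b (r : Ψ.RouteData RP D E₁ E₂ w') : G.Adj r.c r.b := by
  have hch := r.hBrchain
  obtain ⟨x, xs, hx⟩ := List.exists_cons_of_ne_nil r.hBr
  have hb : r.b = x := by simp [b, hx]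
  rw [hx] at hch
  rw [hb]
  exact (List.isChain_cons_cons.1 hch).1

/-- `y ≠ b` (the branch is off the rerouted chain). [folklore] -/
theorem y_ne_b (r : Ψ.RouteData RP D E₁ E₂ w') : r.y ≠ r.b := fun h => r.hBrSP _ r.b_mem_Br (h ▸ r.y_mem_SP)

/-- **Monotonicity**: routing data for `RP ⊆ RP'`, `D ⊆ D'`. [folklore] -/
def mono {RP' D' : Set (Site 2)} (hRP : RP ⊆ RP') (hD : D ⊆ D') : Ψ.RouteData RP' D' E₁ E₂ w' where
  P := r.P
  c := r.c
  y := r.y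
  Br := r.Br
  hP := fun x hx => hRP (r.hP x hx)
  hchain := r.hchain
  hnodup := r.hnodup
  hy := r.hy
  hBr := r.hBr
  hBrD := fun x hx => hD (r.hBrD x hx)
  hBrchain := r.hBrchain
  hBrnodup := r.hBrnodup
  hBrSP := r.hBrSP
  hBrlast := r.hBrlast

/-- `mono` keeps `y`. [folklore] -/
@[simp] theorem mono_y (r : Ψ.RouteData RP D E₁ E₂ w') {RP' D' : Set (Site 2)} (hRP : RP ⊆ RP') (hD : D ⊆ D') : (r.mono hRP hD).y = r.y := rfl

/-- `mono` keeps `b`. [folklore] -/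
@[simp] theorem mono_b (r : Ψ.RouteData RP D E₁ E₂ w') {RP' D' : Set (Site 2)} (hRP : RP ⊆ RP') (hD : D ⊆ D') : (r.mono hRP hD).b = r.b := rfl

/-- **Transport along a graph automorphism covering a map of shadows**: if `sh (α v) = A (sh v)` for all `v`, `A` maps `RP` into `RP'` and `D` into `D'`,
routing data for `(E₁, E₂, w')` maps to routing data for `(α E₁, α E₂, α w')`. [folklore] -/
def map {W : Type} {G' : SimpleGraph W} {Ξ : SqShadow G'} (α : G ≃g G') (A : Site 2 → Site 2) (hA : ∀ v, Ξ.sh (α v) = A (Ψ.sh v))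
    {RP' D' : Set (Site 2)} (hRP : ∀ q ∈ RP, A q ∈ RP') (hD : ∀ q ∈ D, A q ∈ D') : Ξ.RouteData RP' D' (α E₁) (α E₂) (α w') where
  P := r.P.map α
  c := α r.c
  y := α r.y
  Br := r.Br.map α
  hP := by
    intro x hx
    obtain ⟨v, hv, rfl⟩ := List.mem_map.1 hx
    rw [hA]; exact hRP _ (r.hP v hv)
  hchain := by
    have : α E₁ :: (r.P.map α ++ [α E₂]) = (E₁ :: (r.P ++ [E₂])).map α := by simp
    rw [this, List.isChain_map]
    exact r.hchain.imp fun a b h => α.map_adj_iff.2 h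
  hnodup := by
    have : α E₁ :: (r.P.map α ++ [α E₂]) = (E₁ :: (r.P ++ [E₂])).map α := by simp
    rw [this]
    exact r.hnodup.map α.injective
  hy := by
    obtain ⟨l₁, l₂, h⟩ := r.hy
    refine ⟨l₁.map α, l₂.map α, ?_⟩
    have : α E₁ :: (r.P.map α ++ [α E₂]) = (E₁ :: (r.P ++ [E₂])).map α := by simp
    rw [this, h]; simp
  hBr := by simpa using r.hBr
  hBrD := by
    intro x hx
    obtain ⟨v, hv, rfl⟩ := List.mem_map.1 hx
    rw [hA]; exact hD _ (r.hBrD v hv)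
  hBrchain := by
    have : α r.c :: r.Br.map α = (r.c :: r.Br).map α := by simp
    rw [this, List.isChain_map]
    exact r.hBrchain.imp fun a b h => α.map_adj_iff.2 h
  hBrnodup := by
    have : α r.c :: r.Br.map α = (r.c :: r.Br).map α := by simp
    rw [this]
    exact r.hBrnodup.map α.injective
  hBrSP := by
    intro x hx hmem
    obtain ⟨v, hv, rfl⟩ := List.mem_map.1 hx
    have : α E₁ :: (r.P.map α ++ [α E₂]) = (E₁ :: (r.P ++ [E₂])).map α := by simp
    rw [this, List.mem_map] at hmem
    obtain ⟨u, hu, huv⟩ := hmem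
    rw [α.injective huv] at hu
    exact r.hBrSP v hv hu
  hBrlast := by rw [List.getLast_map, r.hBrlast]

/-- `map` acts on `y` by `α`. [folklore] -/
@[simp] theorem map_y {W : Type} {G' : SimpleGraph W} {Ξ : SqShadow G'} (α : G ≃g G') (A : Site 2 → Site 2) (hA : ∀ v, Ξ.sh (α v) = A (Ψ.sh v))
    {RP' D' : Set (Site 2)} (hRP : ∀ q ∈ RP, A q ∈ RP') (hD : ∀ q ∈ D, A q ∈ D') : (r.map α A hA hRP hD).y = α r.y := rfl

/-- `map` acts on `b` by `α`. [folklore] -/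
@[simp] theorem map_b {W : Type} {G' : SimpleGraph W} {Ξ : SqShadow G'} (α : G ≃g G') (A : Site 2 → Site 2) (hA : ∀ v, Ξ.sh (α v) = A (Ψ.sh v))
    {RP' D' : Set (Site 2)} (hRP : ∀ q ∈ RP, A q ∈ RP') (hD : ∀ q ∈ D, A q ∈ D') : (r.map α A hA hRP hD).b = α r.b := by
  simp only [b, map]
  obtain ⟨x, xs, hx⟩ := List.exists_cons_of_ne_nil r.hBr
  simp [hx]

end SqShadow.RouteData

/-! ## §2 Clipped unit blocks and the instance node -/

/-- **The clipped unit block** `sqBall z 3 ∩ {w₀ ≤ z₀ + t} ∩ {w₁ ≤ z₁ + s}` (`t, s ≥ 3`: no clipping in that direction).  These are the cleared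
column sets of the local surgery: full squares inside `B_{3n}`, half-plane-clipped ones along the common side line of `B_{3n}` and `B'_n` and along the
upper-right side of `B_{3n}`. [cite: DuminilCopinSidoraviciusTassion2016, §2.3, proof of Fact 2 (the ball B_R(z))] -/
def sqBlk (z : Site 2) (t s : ℕ) : Set (Site 2) := {w | w ∈ sqBall z 3 ∧ w 0 ≤ z 0 + t ∧ w 1 ≤ z 1 + s}

/-- Membership in a clipped block. [folklore] -/
@[simp] theorem mem_sqBlk {z : Site 2} {t s : ℕ} {w : Site 2} : w ∈ sqBlk z t s ↔ w ∈ sqBall z 3 ∧ w 0 ≤ z 0 + t ∧ w 1 ≤ z 1 + s := Iff.rfl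

/-- Clipped blocks lie in the square of radius `3`. [folklore] -/
theorem sqBlk_subset_sqBall (z : Site 2) (t s : ℕ) : sqBlk z t s ⊆ sqBall z 3 := fun _ h => h.1

/-- Clipped blocks grow with the clipping parameters. [folklore] -/
theorem sqBlk_mono (z : Site 2) {t t' s s' : ℕ} (ht : t ≤ t') (hs : s ≤ s') : sqBlk z t s ⊆ sqBlk z t' s' := by
  intro w hw
  exact ⟨hw.1, hw.2.1.trans (by omega), hw.2.2.trans (by omega)⟩

/-- With both parameters `≥ 3` the block is the full square. [folklore] -/
theorem sqBlk_eq_sqBall (z : Site 2) {t s : ℕ} (ht : 3 ≤ t) (hs : 3 ≤ s) : sqBlk z t s = sqBall z 3 := by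
  ext w
  simp only [mem_sqBlk, and_iff_left_iff_imp]
  intro hw
  rw [mem_sqBall_iff_linear] at hw
  constructor <;> omega

/-- The centre lies in every block. [folklore] -/
theorem self_mem_sqBlk (z : Site 2) (t s : ℕ) : z ∈ sqBlk z t s := by
  exact ⟨centre_mem_sqBall z 3, by omega, by omega⟩

/-- **NODE (instance obligation) — LOCAL LINKAGE in the clipped unit blocks** (DST 2016, §2.3, proof of Fact 2: "Fix `R` in such a way that for any site
`z`, any three distinct neighbors `u, v, w` of `z` and any three distinct sites `u', v', w'` on the boundary of `\overline{B_R}(z)`, there exist three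
disjoint self-avoiding paths in `\overline{B_R}(z) ∖ {z}` connecting `u` to `u'`, `v` to `v'` and `w` to `w'`", in the form the generic surgery consumes):
for every block pair `RP = sqBlk z t_R s_R ⊆ D = sqBlk z t_D s_D` clipped in at most one direction, all terminals `E₁ ≠ E₂` over `RP ∩ sqRing z 3` (the first
and last visits of `γ_min` to `D̄`) and `w'` over `D` whose column is none of `z`, `sh E₁`, `sh E₂` (the exit of the `(P2)`-witness), there is a SWAP PAIR of
routings: two `RouteData` with the successor of the attachment vertex and the first branch vertex exchanged.  An internal obligation on the instance, never
asserted (true for `𝕋 × {0..k}`, `k ≥ 1`, and for the `(111)`-films `F_k`, `k ≥ 3`; false for planar graphs).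
[cite: DuminilCopinSidoraviciusTassion2016, §2.3 (proof of Fact 2, p. 6: the choice of R)] [cite: NewmanTassionWu2017, §3.2 (Def. 3.7)] -/
def SqShadow.LocalLinkage {V : Type} {G : SimpleGraph V} (Ψ : SqShadow G) : Prop :=
  ∀ (z : Site 2) (tR tD sR sD : ℕ), tR ≤ tD → sR ≤ sD → (3 ≤ tR ∨ 3 ≤ sR) →
    ∀ (E₁ E₂ w' : V), E₁ ≠ E₂ → Ψ.sh E₁ ∈ sqBlk z tR sR → Ψ.sh E₁ ∈ sqRing z 3 → Ψ.sh E₂ ∈ sqBlk z tR sR → Ψ.sh E₂ ∈ sqRing z 3 →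
      Ψ.sh w' ∈ sqBlk z tD sD → Ψ.sh w' ≠ z → Ψ.sh w' ≠ Ψ.sh E₁ → Ψ.sh w' ≠ Ψ.sh E₂ →
        ∃ r₁ r₂ : Ψ.RouteData (sqBlk z tR sR) (sqBlk z tD sD) E₁ E₂ w', r₁.y = r₂.b ∧ r₁.b = r₂.y

/-! ## §3 The keyed routing from a swap pair -/

namespace SqShadow

variable {V : Type} {G : SimpleGraph V} (Ψ : SqShadow G)

/-- **From a swap pair, a routing satisfying DST's order condition for the tree's enumeration**: one of the two routings has `vtxKey y < vtxKey b`.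
[cite: DuminilCopinSidoraviciusTassion2016, §2.3, proof of Fact 2 ("(z,v) ≺ (z,w)")] -/
theorem exists_routeData_key [Countable V] {RP D : Set (Site 2)} {E₁ E₂ w' : V} (r₁ r₂ : Ψ.RouteData RP D E₁ E₂ w') (h1 : r₁.y = r₂.b) (h2 : r₁.b = r₂.y) :
    ∃ r : Ψ.RouteData RP D E₁ E₂ w', vtxKey V r.y < vtxKey V r.b := by
  rcases lt_or_ge (vtxKey V r₁.y) (vtxKey V r₁.b) with h | h
  · exact ⟨r₁, h⟩
  · refine ⟨r₂, lt_of_le_of_ne (by rw [← h1, ← h2]; exact h) fun heq => ?_⟩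
    exact r₂.y_ne_b (vtxKey_injective V heq)

/-- **The keyed routing under `LocalLinkage`.** [cite: DuminilCopinSidoraviciusTassion2016, §2.3, proof of Fact 2] -/
theorem exists_routeData_of_localLinkage [Countable V] (hL : Ψ.LocalLinkage) (z : Site 2) {tR tD sR sD : ℕ} (htRD : tR ≤ tD) (hsRD : sR ≤ sD)
    (hone : 3 ≤ tR ∨ 3 ≤ sR) {E₁ E₂ w' : V} (hne : E₁ ≠ E₂) (h1 : Ψ.sh E₁ ∈ sqBlk z tR sR) (h1s : Ψ.sh E₁ ∈ sqRing z 3) (h2 : Ψ.sh E₂ ∈ sqBlk z tR sR)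
    (h2s : Ψ.sh E₂ ∈ sqRing z 3) (h3 : Ψ.sh w' ∈ sqBlk z tD sD) (h3z : Ψ.sh w' ≠ z) (h31 : Ψ.sh w' ≠ Ψ.sh E₁) (h32 : Ψ.sh w' ≠ Ψ.sh E₂) :
    ∃ r : Ψ.RouteData (sqBlk z tR sR) (sqBlk z tD sD) E₁ E₂ w', vtxKey V r.y < vtxKey V r.b := by
  obtain ⟨r₁, r₂, hy, hb⟩ := hL z tR tD sR sD htRD hsRD hone E₁ E₂ w' hne h1 h1s h2 h2s h3 h3z h31 h32
  exact Ψ.exists_routeData_key r₁ r₂ hy hb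

end SqShadow

end Summit.CriticalPhenomena.PercolationContinuityZ3.Theorems.Transplant

end
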